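import Summits.ABC.IUTFork.Conditional.AbcOfSigmaMassRecut
import Summits.ABC.IUTFork.Conditional.AbcOfSigmaMassDisplay
import HarnessLib

/-!
# R-H ROUND 2 EXPONENT PROGRAMME (EXP-SPEC v0, rh-lead g2 2026-08-27T00:54:09Z), piece F5 — THE F1-FREE HALF: «S on a FREE stratum Σ whose
# retained `(j²−1)`-mass is `≥ μ₀·M − Tol` ⟹ [IUTchIV] Thm. 1.10's display DILATED BY `1/μ₀` at EVERY admissible `(P, l)`», cone binder θ-cut
# (`hregC`), and `μ` EXPLICIT at the datum

PROOF-ONLY file (0 definitions, 0 `Prop` facts, no instance, no notation) of the abc-iut cell, rung LADDER-ABC:A2.RESCUE.H; seat abc-iut-rh2-T-1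
(gen 2, re-armed «GO rh2-T-1 EXP-END»). 21-frontier 00:32:01Z: «type the loss sentence as ONE non-vacuous kernel theorem "S|Σ_data ⇒ abc with
exponent 1/μ" on the genuine bed, CUT on hregC, μ explicit in the datum». The ENDPOINT `abcExp_of_licenceOn_mu_content_hregC : ABCWithExponent (1/μ₀)`
(file `Conditional/AbcExpOfSigmaMassContent.lean`) composes THIS file with the exponent-carrying ports F1–F4½ of EXP-SPEC §1 (`ABCWithExponent`,
`Thm110LegendreWith`, `Corollary22With`, q2-cond's dilated door) the minute they land; everything typed HERE needs none of them and is the part of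
F5 that carries the per-datum content: from the three CUT binders to the DILATED DISPLAY at every admissible point, i.e. rh-lead's
`Thm110LegendreWith (1/μ₀)` with its body WRITTEN OUT (`1/6·log q^{∤{2,l}} ≤ (1/μ₀)·[(1 + 20·d_mod/l)·(log-diff + log-cond) + 20·(d*·l + η_prm)]`).

COMPOSED BY NAME (nothing re-typed): this seat's gen-0 files — `cor312UpTo_offTrivialMass_of_licenceOn_chosen` (p477354: per datum, GENERAL `σ`, chosen
realising ideles, `LicenceOn σ ⟹ T.negAbsLogQ ≤ T.negLogTheta + B_triv(σᶜ)`), `dilatedDisplay_of_offSigmaTolerance` (p477154 (R2): `OffSigmaTolerance κ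
(Tol(P,l)) T B` + «Cor. 3.12 up to `B`» + hull estimate ⟹ `(1/6)·((1−κ)·log q) ≤ RHS`), `SigmaMass.tol` (Tol of record); abc-iut-rh2-xi-1's
`Repair.RH.OffSigma.OffSigmaTolerance κ A T B := B ≤ κ·T.gap + A` (p469145); abc-iut-rh2-q2-cond's θ-cut door piece `Cor312Slack.hullEstimateOf_BIII_of_offRegime`
(p476943 §1) and abc-iut-C-cert-1's `Conditional.display_of_not_content` (off the content locus the display is free); abc-iut-L5-t7's
`ThetaPartII.stub_thetaData` (a genuine datum exists at every admissible `(P, l)`); abc-iut-S-d1's `Cor22.exists_isThetaField` /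
`Cor22.not_condP6_five_of_isThetaField` (`l ≠ 5`).

WHAT IS TYPED (`μ₀ ∈ (0, 1]`; `κ := 1 − μ₀`; `Tol(P,l) = ((l+1)/4)·5·d*·l`, `d* = 2¹²·3³·5·d_mod`; `B_III(P,l)` print's Step (v) constant; `σ(P,l,T)` a FREE cell set):
* §1 `dilatedDisplay_of_licenceOn_mu_chosen` — AT ONE genuine datum `T` of `(P, l)` (`l ≥ 5` prime, `l ≠ 5`, `λ ∈ U_X`), ANY context of the sharp
  print-normalised setting at `pilotDataOfK T.D T.K` with the chosen ideles, ANY `σ`: [LIC] `LicenceOn … σ` ∧ [MU] `OffSigmaTolerance (1−μ₀) (Tol(P,l)) T (B_triv(σᶜ))`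
  ∧ the hull estimate with `B_III(P,l)` ⟹ **`1/6·log q^{∤{2,l}}(λ) ≤ (1/μ₀)·[(1 + 20·d_mod/l)·(log-diff + log-cond) + 20·(d*·l + η_prm)]`** for every `η_prm`
  (`IsEtaPrm`) — print's display with the WHOLE right-hand side multiplied by `Λ = 1/μ₀` (rh-lead's ONE coefficient convention).
* §2 **`displayWith_pointwise_of_licenceOn_mu_content_hregC`** — explicit 3 = [LIC-C] 1 · [MU-C] 1 · [CONE-C] 1, the binders of this seat's record
  endpoint `abc_of_licenceOn_of_offTrivialMass_le_content_hregC` (p477900) VERBATIM except that [THR-C] «`B_triv(σᶜ) ≤ Tol(P,l)`» becomes the RELATIVE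
  [MU-C] «`OffSigmaTolerance (1−μ₀) (Tol(P,l)) T (B_triv(σᶜ))`» (⟺ «`mass(σ) ≥ μ₀·T.gap − Tol(P,l)`», companion `AbcExpOfSigmaMassMu`), each demanded ONLY on the content locus
  «`6·(1 + 20·d_mod/l)·(log-diff + log-cond) + 120·d*·l < log q^{∤{2,l}}`» ⟹ for EVERY `η_prm` and EVERY admissible `(P, l)` (`P ∈ UP`, `l ≥ 5` prime,
  `AdmitsCore`, (P2), (P5), (P6)) the `1/μ₀`-dilated display. Off the content locus print's display holds by its own constant and the dilated one
  a fortiori (`1/μ₀ ≥ 1`, right-hand side `≥ 0`) — NOTHING is assumed there; on it a genuine datum exists, [CONE-C] gives the hull estimate off the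
  slot-constant regime (on it: pinned junction, a theorem), and §1 applies.
* `μ` EXPLICIT lives in the companion `Conditional/AbcExpOfSigmaMassMu.lean` (same seat, same date): [MU] at the bed ⟺ `μ₀·T.gap ≤ mass(σ) + Tol(P,l)`
  (w-1's `M = T.gap`), the `μ₀ = 1` regression ([MU-C]|_{μ₀=1} IS [THR-C]: §2 at `μ₀ = 1` has EXACTLY p477900's hypotheses and concludes print's undilated
  display), the empty-stratum reading ([MU] at `σ = ∅` ⟺ `μ₀·T.gap ≤ Tol(P,l)` — rh2-ref-3's μ₀-family sanity), monotonicity in `μ₀`.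
HONEST FRAMING: CONDITIONAL; «the dilated display follows from these hypotheses AS TYPED», nothing more; [LIC-C]/[MU-C]/[CONE-C] are ASSUMPTION LABELS,
never asserted, refutable datum by datum (with `σ = Σ_data`, MIN-SLICE (iii): `μ(T) < 1` at every tabulated deep datum); NOT a uniform abc and not an
exponent claim about genuine data — whether genuine data supply `μ(T) ≥ μ₀ > 0` on the content locus is OPEN (Q3 / round 3); nothing here asserts that
abc is proved or refuted or that [IUTchIII] Cor. 3.12 / [IUTchIV] Thm. 1.10 holds or fails anywhere; no side taken on any author (Mochizuki /
Scholze–Stix / Joshi / Dupuy–Hilado); typed ≠ proved; instantiated ≠ endorsed. [cite: Mochizuki2012, IUTchIII Cor. 3.12 p. 173–174, Step (xi-f) p. 184;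
IUTchIV Thm. 1.10 pp. 22–31 (Step (v) pp. 27–28, Steps (viii)–(x) pp. 30–32), Prop. 1.6 p. 16, Cor. 2.2 (ii) pp. 41–48 (p. 46 l. 1)]
[cite: DupuyHilado2025, §3.3, §3.9] [claim: Mochizuki2012, status: disputed] for every IUT locution. Axioms: standard.
-/

noncomputable section

open Set Function NumberField IsDedekindDomain

namespace Summit.ABC.IUTFork.Conditional.SigmaMass

open Summit.ABC.IUTFork.Thm311 Summit.ABC.IUTFork.Thm311.Real Summit.ABC.IUTFork.Cor312 Summit.ABC.IUTFork.Cor312.Setting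
  Summit.ABC.IUTFork.Cor312Vol Summit.ABC.IUTFork.Cor312Prov Literature.IUT.LogThetaLattice Literature.IUT.LogVolume
  Literature.IUT.HodgeTheaters Literature.IUT.LogVolume.ThetaData
  Literature.NumberTheory.DiophantineGeometry.GenEll Summit.ABC.ABC.Theorems
  Summit.ABC.IUTFork.Repair.RH.SigmaLicence Summit.ABC.IUTFork.Repair.RH.SigmaStrataEq Summit.ABC.IUTFork.Repair.RH.SigmaMass
  Summit.ABC.IUTFork.Repair.RH.OffSigma Summit.ABC.IUTFork.Conditional

/-! ## §1 At ONE genuine datum: licence on `σ` + relative tolerance + hull estimate ⟹ the `1/μ₀`-dilated display -/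

/-- **PER DATUM, GENERAL σ, CHOSEN IDELES: «S on Σ with `B_triv(σᶜ) ≤ (1−μ₀)·T.gap + Tol(P,l)` ⟹ the display dilated by `1/μ₀`».** At `(P, l)` with
`l ≥ 5` prime, `l ≠ 5`, `λ ∈ U_X`, for every `η_prm` (`IsEtaPrm`), every genuine Θ-volume datum `T`, every context of abc-iut-c312-7's sharp
print-normalised setting over `T.K` at `pilotDataOfK T.D T.K` with the CHOSEN realising ideles, every cell set `σ` and every `μ₀ > 0`: [LIC] the
(xi-f) licence on `σ` for OUR typed hull, [MU] abc-iut-rh2-xi-1's `OffSigmaTolerance (1−μ₀) (Tol(P,l)) T (B_triv(σᶜ))` and the hull estimate with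
`B_III(P,l)` give `1/6·log q^{∤{2,l}}(λ) ≤ (1/μ₀)·[(1 + 20·d_mod/l)·(log-diff + log-cond) + 20·(d*·l + η_prm)]` — this seat's
`cor312UpTo_offTrivialMass_of_licenceOn_chosen` (p477354), then `dilatedDisplay_of_offSigmaTolerance` (p477154) at `κ := 1 − μ₀`, then division by `μ₀`.
CONDITIONAL; «holds AS TYPED for OUR hull»; no side taken. [cite: Mochizuki2012, IUTchIII Cor. 3.12 p. 173–174; IUTchIV Thm. 1.10 Steps (viii)–(x)
p. 30–32; Cor. 2.2 (ii) p. 46] [claim: Mochizuki2012, status: disputed] -/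
theorem dilatedDisplay_of_licenceOn_mu_chosen {P : NFPoint} {l : ℕ} (hl : l.Prime) (h5 : 5 ≤ l) (hne : l ≠ 5) {η : ℝ} (hη : IsEtaPrm η)
    (T : Cor22.ThetaVolumeDatumAt P l) (hU : P.InU) {μ₀ : ℝ} (hμ₀ : 0 < μ₀) :
    letI := T.instFieldF; letI := T.instNumberFieldF; letI := T.instAlgebraF; letI := T.instFieldK;
        letI := T.instNumberFieldK; letI := T.instAlgebraK; letI := T.instFieldFbar; letI := T.instAlgebraFbar;
        letI := T.instAlgebraKFbar; letI := T.instIsElliptic;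
    ∀ (M : Type) [Field M] [NumberField M]
      (archPk : ∀ (j : (thetaIndex (pilotDataOfK T.D T.K)).Label) (vQ : (thetaIndex (pilotDataOfK T.D T.K)).VQ),
        Set ((logShellsDH (pilotDataOfK T.D T.K) (analyticLogv T.K)).Packet j vQ))
      (archSub : ∀ (j : (thetaIndex (pilotDataOfK T.D T.K)).Label) (v : (thetaIndex (pilotDataOfK T.D T.K)).V),
        Set ((logShellsDH (pilotDataOfK T.D T.K) (analyticLogv T.K)).Packet j ((thetaIndex (pilotDataOfK T.D T.K)).over v)))
      (Ψ : ℤ → ∀ v : (thetaIndex (pilotDataOfK T.D T.K)).V, v ∈ (thetaIndex (pilotDataOfK T.D T.K)).Vbad →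
        Set ((logShellsDH (pilotDataOfK T.D T.K) (analyticLogv T.K)).StarPacket v))
      (act : ℤ → ∀ v : (thetaIndex (pilotDataOfK T.D T.K)).V, v ∈ (thetaIndex (pilotDataOfK T.D T.K)).Vbad →
        (logShellsDH (pilotDataOfK T.D T.K) (analyticLogv T.K)).StarPacket v →
          Module.End ℚ ((logShellsDH (pilotDataOfK T.D T.K) (analyticLogv T.K)).StarPacket v))
      (Mmod : ℤ → ∀ j : (thetaIndex (pilotDataOfK T.D T.K)).LabelStar,
        Set ((logShellsDH (pilotDataOfK T.D T.K) (analyticLogv T.K)).GlobalPacket j.1))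
      (region : ℤ → ∀ j : (thetaIndex (pilotDataOfK T.D T.K)).LabelStar, FinDivisor M →
        ∀ vQ : (thetaIndex (pilotDataOfK T.D T.K)).VQ, Set ((logShellsDH (pilotDataOfK T.D T.K) (analyticLogv T.K)).Packet j.1 vQ))
      (n : ℤ) {HT : Type} {LogLink : HT → HT → Type} {IsFull : ∀ {s t : HT}, LogLink s t → Prop}
      (lat : LGPGaussianLogThetaLattice LogLink IsFull)
      {Frd : Type} {IsoF : Frd → Frd → Type} {Ob : Frd → Type} {realify : Frd → Frd} {Strip : Type}
      {IsoS : Strip → Strip → Type}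
      {Mv : ∀ v : (thetaIndex (pilotDataOfK T.D T.K)).V, v ∈ (thetaIndex (pilotDataOfK T.D T.K)).Vbad → Type}
      [∀ v h, Monoid (Mv v h)]
      (sig : GlobalLGPFrobenioidSignature (thetaIndex (pilotDataOfK T.D T.K)).lstar (thetaIndex (pilotDataOfK T.D T.K)).V
        (· ∈ (thetaIndex (pilotDataOfK T.D T.K)).Vbad) Frd IsoF Ob realify Strip IsoS Mv)
      (split : SplittingMonoids Mv) {ObΔ : Type}
      {N : ∀ v : (thetaIndex (pilotDataOfK T.D T.K)).V, v ∈ (thetaIndex (pilotDataOfK T.D T.K)).Vbad → Type} [∀ v h, Monoid (N v h)]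
      (qData : QPilotData ObΔ N)
      (σ : Set (Fin (thetaIndex (pilotDataOfK T.D T.K)).lstar × (thetaIndex (pilotDataOfK T.D T.K)).VQ)),
      LicenceOn
        (settingPrVolSharp (pilotDataOfK T.D T.K) (logvAnalytic_analyticLogv (F := T.K)) M archPk archSub Ψ act Mmod region n lat
            sig split qData (exists_realising_qIdeles_pilotDataOfK T.D).choose (exists_realising_thetaIdeles_pilotDataOfK T.D).choose
            (exists_realising_qIdeles_pilotDataOfK T.D).choose_spec.1 (exists_realising_qIdeles_pilotDataOfK T.D).choose_spec.2.1) σ →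
      OffSigmaTolerance (1 - μ₀) (tol P l) T
        (offTrivialMass
          (settingPrVolSharp (pilotDataOfK T.D T.K) (logvAnalytic_analyticLogv (F := T.K)) M archPk archSub Ψ act Mmod region n lat
            sig split qData (exists_realising_qIdeles_pilotDataOfK T.D).choose (exists_realising_thetaIdeles_pilotDataOfK T.D).choose
            (exists_realising_qIdeles_pilotDataOfK T.D).choose_spec.1 (exists_realising_qIdeles_pilotDataOfK T.D).choose_spec.2.1) σ) →
      T.HullEstimateOf
        (((l : ℝ) + 1) / 4 *
          ((1 + 12 * (Cor22.dmod P : ℝ) / l) * (P.logDiff + Cor22.logCondAvoid P {2, l})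
            + 2 * Real.log l + 52
            + 20 / 3 * Real.log (((2 ^ 12 * 3 ^ 3 * 5 * Cor22.dmod P : ℕ) : ℝ) * (l : ℝ))
              * (Nat.primeCounting (2 ^ 12 * 3 ^ 3 * 5 * Cor22.dmod P * l) : ℝ))) →
      1 / 6 * Cor22.logQAvoid P {2, l} ≤
        1 / μ₀ * ((1 + 20 * (Cor22.dmod P : ℝ) / l) * (P.logDiff + Cor22.logCondAvoid P {2, l})
          + 20 * (2 ^ 12 * 3 ^ 3 * 5 * (Cor22.dmod P : ℝ) * l + η)) := by
  intro M _ _ archPk archSub Ψ act Mmod region n HT LogLink IsFull lat Frd IsoF Ob realify Strip IsoS Mv _ sig split ObΔ N _ qData σ hσ htol h2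
  letI := T.instFieldF; letI := T.instNumberFieldF; letI := T.instAlgebraF; letI := T.instFieldK
  letI := T.instNumberFieldK; letI := T.instAlgebraK; letI := T.instFieldFbar; letI := T.instAlgebraFbar
  letI := T.instAlgebraKFbar; letI := T.instIsElliptic
  have h1 := cor312UpTo_offTrivialMass_of_licenceOn_chosen T M archPk archSub Ψ act Mmod region n lat sig split qData σ hσ
  have hd := dilatedDisplay_of_offSigmaTolerance hl h5 hne hη T hU htol (by linarith) h2
  have e : 1 - (1 - μ₀) = μ₀ := by ring
  rw [e] at hd
  have hd' : 1 / 6 * Cor22.logQAvoid P {2, l} * μ₀ ≤ ((1 + 20 * (Cor22.dmod P : ℝ) / l) * (P.logDiff + Cor22.logCondAvoid P {2, l})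
          + 20 * (2 ^ 12 * 3 ^ 3 * 5 * (Cor22.dmod P : ℝ) * l + η)) := by
    have e' : 1 / 6 * Cor22.logQAvoid P {2, l} * μ₀ = 1 / 6 * (μ₀ * Cor22.logQAvoid P {2, l}) := by ring
    rw [e']
    exact hd
  rw [one_div_mul_eq_div μ₀]
  exact (le_div_iff₀ hμ₀).2 hd'

/-! ## §2 EVERY admissible `(P, l)`: the three θ-cut binders ⟹ the `1/μ₀`-dilated display pointwise (`Thm110LegendreWith (1/μ₀)`, body written out) -/

/-- **`displayWith_pointwise_of_licenceOn_mu_content_hregC` — F5's F1-free half.** Explicit 3 = [LIC-C] 1 · [MU-C] 1 · [CONE-C] 1, for `μ₀ ∈ (0, 1]`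
and a FREE stratum `σ(P,l,T)`: IF at every admissible `(P, l)` ON THE CONTENT LOCUS «`6·(1 + 20·d_mod/l)·(log-diff + log-cond) + 120·d*·l <
log q^{∤{2,l}}`» and every genuine Θ-volume datum `T` [LIC-C] the (xi-f) licence holds at the cells of `σ` for OUR typed hull at the chosen realising
ideles, [MU-C] `OffSigmaTolerance (1−μ₀) (Tol(P,l)) T (B_triv(σᶜ))` (⟺ retained mass `≥ μ₀·T.gap − Tol(P,l)`, companion `AbcExpOfSigmaMassMu`), and [CONE-C] `hregC` (abc-iut-C-cert-1's
binder VERBATIM, as in p476943 / p477900), THEN for every `η_prm` (`IsEtaPrm`) and EVERY admissible `(P, l)` (`P ∈ UP`, `l ≥ 5` prime, `AdmitsCore`, (P2),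
(P5), (P6)): `1/6·log q^{∤{2,l}}(λ) ≤ (1/μ₀)·[(1 + 20·d_mod/l)·(log-diff + log-cond) + 20·(d*·l + η_prm)]` — rh-lead's `Thm110LegendreWith (1/μ₀)` with
its body written out. Pointwise: `l ≠ 5` (abc-iut-S-d1: (P6) fails at `5` over a theta field); off the content locus the undilated display is free
(`display_of_not_content`) and `1/μ₀ ≥ 1` only weakens it; on it `ThetaPartII.stub_thetaData`, q2-cond's `hullEstimateOf_BIII_of_offRegime` from
[CONE-C], and §1. At `μ₀ = 1` the hypotheses are EXACTLY p477900's ([MU-C]|₁ = [THR-C], `offSigmaTolerance_sub_self_iff`) and the conclusion is print's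
display. CONDITIONAL; «follows from these hypotheses AS TYPED», nothing more; NOT a statement about genuine data (whether they supply `μ(T) ≥ μ₀` on the
content locus is OPEN); no side taken on [IUTchIII] Cor. 3.12 or on any author. [cite: Mochizuki2012, IUTchIV Thm. 1.10 pp. 22–31; Cor. 2.2 (ii) p. 46 l. 1]
[cite: Mochizuki2012, IUTchIII Cor. 3.12 p. 174] [claim: Mochizuki2012, status: disputed] -/
theorem displayWith_pointwise_of_licenceOn_mu_content_hregC {μ₀ : ℝ} (hμ₀ : 0 < μ₀) (hμ₁ : μ₀ ≤ 1)
    (M : ∀ (P : NFPoint) (l : ℕ) (T : Cor22.ThetaVolumeDatumAt P l), Type) [∀ P l T, Field (M P l T)] [∀ P l T, NumberField (M P l T)]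
    (archPk : ∀ (P : NFPoint) (l : ℕ) (T : Cor22.ThetaVolumeDatumAt P l), letI := T.instFieldF; letI := T.instNumberFieldF; letI := T.instAlgebraF; letI := T.instFieldK;
        letI := T.instNumberFieldK; letI := T.instAlgebraK; letI := T.instFieldFbar; letI := T.instAlgebraFbar;
        letI := T.instAlgebraKFbar; letI := T.instIsElliptic;
      ∀ (j : (thetaIndex (pilotDataOfK T.D T.K)).Label) (vQ : (thetaIndex (pilotDataOfK T.D T.K)).VQ), Set ((logShellsDH (pilotDataOfK T.D T.K) (analyticLogv T.K)).Packet j vQ))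
    (archSub : ∀ (P : NFPoint) (l : ℕ) (T : Cor22.ThetaVolumeDatumAt P l), letI := T.instFieldF; letI := T.instNumberFieldF; letI := T.instAlgebraF; letI := T.instFieldK;
        letI := T.instNumberFieldK; letI := T.instAlgebraK; letI := T.instFieldFbar; letI := T.instAlgebraFbar;
        letI := T.instAlgebraKFbar; letI := T.instIsElliptic;
      ∀ (j : (thetaIndex (pilotDataOfK T.D T.K)).Label) (v : (thetaIndex (pilotDataOfK T.D T.K)).V), Set ((logShellsDH (pilotDataOfK T.D T.K) (analyticLogv T.K)).Packet j ((thetaIndex (pilotDataOfK T.D T.K)).over v)))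
    (Ψ : ∀ (P : NFPoint) (l : ℕ) (T : Cor22.ThetaVolumeDatumAt P l), letI := T.instFieldF; letI := T.instNumberFieldF; letI := T.instAlgebraF; letI := T.instFieldK;
        letI := T.instNumberFieldK; letI := T.instAlgebraK; letI := T.instFieldFbar; letI := T.instAlgebraFbar;
        letI := T.instAlgebraKFbar; letI := T.instIsElliptic;
      ℤ → ∀ v : (thetaIndex (pilotDataOfK T.D T.K)).V, v ∈ (thetaIndex (pilotDataOfK T.D T.K)).Vbad → Set ((logShellsDH (pilotDataOfK T.D T.K) (analyticLogv T.K)).StarPacket v))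
    (act : ∀ (P : NFPoint) (l : ℕ) (T : Cor22.ThetaVolumeDatumAt P l), letI := T.instFieldF; letI := T.instNumberFieldF; letI := T.instAlgebraF; letI := T.instFieldK;
        letI := T.instNumberFieldK; letI := T.instAlgebraK; letI := T.instFieldFbar; letI := T.instAlgebraFbar;
        letI := T.instAlgebraKFbar; letI := T.instIsElliptic;
      ℤ → ∀ v : (thetaIndex (pilotDataOfK T.D T.K)).V, v ∈ (thetaIndex (pilotDataOfK T.D T.K)).Vbad → (logShellsDH (pilotDataOfK T.D T.K) (analyticLogv T.K)).StarPacket v → Module.End ℚ ((logShellsDH (pilotDataOfK T.D T.K) (analyticLogv T.K)).StarPacket v))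
    (Mmod : ∀ (P : NFPoint) (l : ℕ) (T : Cor22.ThetaVolumeDatumAt P l), letI := T.instFieldF; letI := T.instNumberFieldF; letI := T.instAlgebraF; letI := T.instFieldK;
        letI := T.instNumberFieldK; letI := T.instAlgebraK; letI := T.instFieldFbar; letI := T.instAlgebraFbar;
        letI := T.instAlgebraKFbar; letI := T.instIsElliptic;
      ℤ → ∀ j : (thetaIndex (pilotDataOfK T.D T.K)).LabelStar, Set ((logShellsDH (pilotDataOfK T.D T.K) (analyticLogv T.K)).GlobalPacket j.1))
    (region : ∀ (P : NFPoint) (l : ℕ) (T : Cor22.ThetaVolumeDatumAt P l), letI := T.instFieldF; letI := T.instNumberFieldF; letI := T.instAlgebraF; letI := T.instFieldK;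
        letI := T.instNumberFieldK; letI := T.instAlgebraK; letI := T.instFieldFbar; letI := T.instAlgebraFbar;
        letI := T.instAlgebraKFbar; letI := T.instIsElliptic;
      ℤ → ∀ j : (thetaIndex (pilotDataOfK T.D T.K)).LabelStar, FinDivisor (M P l T) → ∀ vQ : (thetaIndex (pilotDataOfK T.D T.K)).VQ, Set ((logShellsDH (pilotDataOfK T.D T.K) (analyticLogv T.K)).Packet j.1 vQ))
    (n : ∀ (P : NFPoint) (l : ℕ) (T : Cor22.ThetaVolumeDatumAt P l), ℤ)
    {HT : ∀ (P : NFPoint) (l : ℕ) (T : Cor22.ThetaVolumeDatumAt P l), Type} {LogLink : ∀ (P : NFPoint) (l : ℕ) (T : Cor22.ThetaVolumeDatumAt P l), HT P l T → HT P l T → Type}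
    {IsFull : ∀ (P : NFPoint) (l : ℕ) (T : Cor22.ThetaVolumeDatumAt P l), ∀ {s t : HT P l T}, LogLink P l T s t → Prop}
    (lat : ∀ (P : NFPoint) (l : ℕ) (T : Cor22.ThetaVolumeDatumAt P l), LGPGaussianLogThetaLattice (LogLink P l T) (IsFull P l T))
    {Frd : ∀ (P : NFPoint) (l : ℕ) (T : Cor22.ThetaVolumeDatumAt P l), Type} {IsoF : ∀ (P : NFPoint) (l : ℕ) (T : Cor22.ThetaVolumeDatumAt P l), Frd P l T → Frd P l T → Type} {Ob : ∀ (P : NFPoint) (l : ℕ) (T : Cor22.ThetaVolumeDatumAt P l), Frd P l T → Type}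
    {realify : ∀ (P : NFPoint) (l : ℕ) (T : Cor22.ThetaVolumeDatumAt P l), Frd P l T → Frd P l T} {Strip : ∀ (P : NFPoint) (l : ℕ) (T : Cor22.ThetaVolumeDatumAt P l), Type} {IsoS : ∀ (P : NFPoint) (l : ℕ) (T : Cor22.ThetaVolumeDatumAt P l), Strip P l T → Strip P l T → Type}
    {Mv : ∀ (P : NFPoint) (l : ℕ) (T : Cor22.ThetaVolumeDatumAt P l), letI := T.instFieldF; letI := T.instNumberFieldF; letI := T.instAlgebraF; letI := T.instFieldK;
        letI := T.instNumberFieldK; letI := T.instAlgebraK; letI := T.instFieldFbar; letI := T.instAlgebraFbar;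
        letI := T.instAlgebraKFbar; letI := T.instIsElliptic;
      ∀ v : (thetaIndex (pilotDataOfK T.D T.K)).V, v ∈ (thetaIndex (pilotDataOfK T.D T.K)).Vbad → Type}
    [∀ P l T v h, Monoid (Mv P l T v h)]
    (sig : ∀ (P : NFPoint) (l : ℕ) (T : Cor22.ThetaVolumeDatumAt P l), letI := T.instFieldF; letI := T.instNumberFieldF; letI := T.instAlgebraF; letI := T.instFieldK;
        letI := T.instNumberFieldK; letI := T.instAlgebraK; letI := T.instFieldFbar; letI := T.instAlgebraFbar;
        letI := T.instAlgebraKFbar; letI := T.instIsElliptic;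
      GlobalLGPFrobenioidSignature (thetaIndex (pilotDataOfK T.D T.K)).lstar (thetaIndex (pilotDataOfK T.D T.K)).V (· ∈ (thetaIndex (pilotDataOfK T.D T.K)).Vbad) (Frd P l T) (IsoF P l T) (Ob P l T) (realify P l T)
        (Strip P l T) (IsoS P l T) (Mv P l T))
    (split : ∀ (P : NFPoint) (l : ℕ) (T : Cor22.ThetaVolumeDatumAt P l), SplittingMonoids (Mv P l T))
    {ObΔ : ∀ (P : NFPoint) (l : ℕ) (T : Cor22.ThetaVolumeDatumAt P l), Type} {N : ∀ (P : NFPoint) (l : ℕ) (T : Cor22.ThetaVolumeDatumAt P l), letI := T.instFieldF; letI := T.instNumberFieldF; letI := T.instAlgebraF; letI := T.instFieldK;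
        letI := T.instNumberFieldK; letI := T.instAlgebraK; letI := T.instFieldFbar; letI := T.instAlgebraFbar;
        letI := T.instAlgebraKFbar; letI := T.instIsElliptic;
      ∀ v : (thetaIndex (pilotDataOfK T.D T.K)).V, v ∈ (thetaIndex (pilotDataOfK T.D T.K)).Vbad → Type}
    [∀ P l T v h, Monoid (N P l T v h)] (qData : ∀ (P : NFPoint) (l : ℕ) (T : Cor22.ThetaVolumeDatumAt P l), QPilotData (ObΔ P l T) (N P l T))
    -- the FREE stratum: a cell set at every genuine datum
    (σ : ∀ (P : NFPoint) (l : ℕ) (T : Cor22.ThetaVolumeDatumAt P l), letI := T.instFieldF; letI := T.instNumberFieldF; letI := T.instAlgebraF; letI := T.instFieldK;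
        letI := T.instNumberFieldK; letI := T.instAlgebraK; letI := T.instFieldFbar; letI := T.instAlgebraFbar;
        letI := T.instAlgebraKFbar; letI := T.instIsElliptic;
      Set (Fin (thetaIndex (pilotDataOfK T.D T.K)).lstar × (thetaIndex (pilotDataOfK T.D T.K)).VQ))
    -- [LIC-C] «S on Σ» on the content locus: the (xi-f) licence at the cells of `σ`, OUR typed hull, chosen realising ideles
    (hLic : ∀ P : NFPoint, P ∈ UP → ∀ l : ℕ, l.Prime → 5 ≤ l →
      Cor22.AdmitsCore P → Cor22.CondP2 P l → Cor22.CondP5 P l → Cor22.CondP6 P l →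
      6 * ((1 + 20 * (Cor22.dmod P : ℝ) / l) * (P.logDiff + Cor22.logCondAvoid P {2, l}))
          + 120 * (2 ^ 12 * 3 ^ 3 * 5 * (Cor22.dmod P : ℝ) * l) < Cor22.logQAvoid P {2, l} →
      ∀ T : Cor22.ThetaVolumeDatumAt P l, letI := T.instFieldF; letI := T.instNumberFieldF; letI := T.instAlgebraF; letI := T.instFieldK;
        letI := T.instNumberFieldK; letI := T.instAlgebraK; letI := T.instFieldFbar; letI := T.instAlgebraFbar;
        letI := T.instAlgebraKFbar; letI := T.instIsElliptic;
      LicenceOn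
        (settingPrVolSharp (pilotDataOfK T.D T.K) (logvAnalytic_analyticLogv (F := T.K)) (M P l T) (archPk P l T) (archSub P l T) (Ψ P l T)
          (act P l T) (Mmod P l T) (region P l T) (n P l T) (lat P l T) (sig P l T) (split P l T) (qData P l T)
          (exists_realising_qIdeles_pilotDataOfK T.D).choose
          (exists_realising_thetaIdeles_pilotDataOfK T.D).choose
          (exists_realising_qIdeles_pilotDataOfK T.D).choose_spec.1
          (exists_realising_qIdeles_pilotDataOfK T.D).choose_spec.2.1) (σ P l T))
    -- [MU-C] the RELATIVE tolerance there: `B_triv(σᶜ) ≤ (1−μ₀)·T.gap + Tol(P,l)` (⟺ mass(σ) ≥ μ₀·T.gap − Tol(P,l)), xi-1's `OffSigmaTolerance` VERBATIM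
    (hMu : ∀ P : NFPoint, P ∈ UP → ∀ l : ℕ, l.Prime → 5 ≤ l →
      Cor22.AdmitsCore P → Cor22.CondP2 P l → Cor22.CondP5 P l → Cor22.CondP6 P l →
      6 * ((1 + 20 * (Cor22.dmod P : ℝ) / l) * (P.logDiff + Cor22.logCondAvoid P {2, l}))
          + 120 * (2 ^ 12 * 3 ^ 3 * 5 * (Cor22.dmod P : ℝ) * l) < Cor22.logQAvoid P {2, l} →
      ∀ T : Cor22.ThetaVolumeDatumAt P l, letI := T.instFieldF; letI := T.instNumberFieldF; letI := T.instAlgebraF; letI := T.instFieldK;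
        letI := T.instNumberFieldK; letI := T.instAlgebraK; letI := T.instFieldFbar; letI := T.instAlgebraFbar;
        letI := T.instAlgebraKFbar; letI := T.instIsElliptic;
      OffSigmaTolerance (1 - μ₀) (tol P l) T
        (offTrivialMass
          (settingPrVolSharp (pilotDataOfK T.D T.K) (logvAnalytic_analyticLogv (F := T.K)) (M P l T) (archPk P l T) (archSub P l T) (Ψ P l T)
          (act P l T) (Mmod P l T) (region P l T) (n P l T) (lat P l T) (sig P l T) (split P l T) (qData P l T)
          (exists_realising_qIdeles_pilotDataOfK T.D).choose
          (exists_realising_thetaIdeles_pilotDataOfK T.D).choose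
          (exists_realising_qIdeles_pilotDataOfK T.D).choose_spec.1
          (exists_realising_qIdeles_pilotDataOfK T.D).choose_spec.2.1) (σ P l T)))
    -- [CONE-C] abc-iut-C-cert-1's `hregC` VERBATIM
    (hregC : ∀ P : NFPoint, P ∈ UP → ∀ l : ℕ, l.Prime → 5 ≤ l →
      Cor22.AdmitsCore P → Cor22.CondP2 P l → Cor22.CondP5 P l → Cor22.CondP6 P l →
      6 * ((1 + 20 * (Cor22.dmod P : ℝ) / l) * (P.logDiff + Cor22.logCondAvoid P {2, l}))
          + 120 * (2 ^ 12 * 3 ^ 3 * 5 * (Cor22.dmod P : ℝ) * l) < Cor22.logQAvoid P {2, l} →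
      ∀ T : Cor22.ThetaVolumeDatumAt P l,
        (letI := T.instFieldF; letI := T.instNumberFieldF; letI := T.instAlgebraF; letI := T.instFieldK
         letI := T.instNumberFieldK; letI := T.instAlgebraK; letI := T.instFieldFbar; letI := T.instAlgebraFbar
         letI := T.instAlgebraKFbar; letI := T.instIsElliptic
         ¬ (∀ p ∈ T.I.supportPrimes, ∀ v w : placesOver (fieldOfModuli T.E) p,
            (Summit.ABC.IUTFork.DHData.ofInput T.I).logQloc p v = (Summit.ABC.IUTFork.DHData.ofInput T.I).logQloc p w)) →
        T.HullEstimateOf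
          (((l : ℝ) + 1) / 4 *
            ((1 + 12 * (Cor22.dmod P : ℝ) / l) * (P.logDiff + Cor22.logCondAvoid P {2, l})
              + 2 * Real.log l + 52
              + 20 / 3 * Real.log (((2 ^ 12 * 3 ^ 3 * 5 * Cor22.dmod P : ℕ) : ℝ) * (l : ℝ))
                * (Nat.primeCounting (2 ^ 12 * 3 ^ 3 * 5 * Cor22.dmod P * l) : ℝ)))) :
    ∀ η : ℝ, IsEtaPrm η → ∀ P : NFPoint, P ∈ UP → ∀ l : ℕ, l.Prime → 5 ≤ l →
      Cor22.AdmitsCore P → Cor22.CondP2 P l → Cor22.CondP5 P l → Cor22.CondP6 P l →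
      1 / 6 * Cor22.logQAvoid P {2, l} ≤
        1 / μ₀ * ((1 + 20 * (Cor22.dmod P : ℝ) / l) * (P.logDiff + Cor22.logCondAvoid P {2, l})
          + 20 * (2 ^ 12 * 3 ^ 3 * 5 * (Cor22.dmod P : ℝ) * l + η)) := by
  intro η hη P hP l hl h5 hcore hP2 hP5 h6
  have hU : P.InU := (show P.InU ∧ P.IsMinimal from hP).1
  have hne : l ≠ 5 := by
    rintro rfl
    obtain ⟨F, hNF, hF⟩ := Cor22.exists_isThetaField P hU
    haveI := hNF
    exact Cor22.not_condP6_five_of_isThetaField hU F hF h6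
  by_cases hct : 6 * ((1 + 20 * (Cor22.dmod P : ℝ) / l) * (P.logDiff + Cor22.logCondAvoid P {2, l}))
          + 120 * (2 ^ 12 * 3 ^ 3 * 5 * (Cor22.dmod P : ℝ) * l) < Cor22.logQAvoid P {2, l}
  swap
  · -- OFF the content locus: print's display holds by its own constant; `1/μ₀ ≥ 1` only weakens it — NOTHING assumed
    have hD := display_of_not_content (P := P) (l := l) hη.1 hct
    unfold Cor22.Display at hD
    have hR : 0 ≤ ((1 + 20 * (Cor22.dmod P : ℝ) / l) * (P.logDiff + Cor22.logCondAvoid P {2, l})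
          + 20 * (2 ^ 12 * 3 ^ 3 * 5 * (Cor22.dmod P : ℝ) * l + η)) := by
      have hLD : 0 ≤ P.logDiff := P.logDiff_nonneg
      have hLC : 0 ≤ Cor22.logCondAvoid P {2, l} := Cor22.logCondAvoid_nonneg P {2, l}
      have hη0 : 0 < η := hη.1
      positivity
    have hΛ : 1 ≤ 1 / μ₀ := by
      rw [le_div_iff₀ hμ₀]
      linarith
    exact hD.trans (le_mul_of_one_le_left hR hΛ)
  -- ON the content locus: a genuine datum exists; [CONE-C] gives the hull estimate off the slot-constant regime; §1
  obtain ⟨T⟩ := ThetaPartII.stub_thetaData P hP l hl h5 hcore hP2 hP5 h6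
  have h2 := Cor312Slack.hullEstimateOf_BIII_of_offRegime hP hl h5 hcore hP2 hP5 h6 T (hregC P hP l hl h5 hcore hP2 hP5 h6 hct T)
  exact dilatedDisplay_of_licenceOn_mu_chosen hl h5 hne hη T hU hμ₀ (M P l T) (archPk P l T) (archSub P l T) (Ψ P l T) (act P l T)
    (Mmod P l T) (region P l T) (n P l T) (lat P l T) (sig P l T) (split P l T) (qData P l T) (σ P l T)
    (hLic P hP l hl h5 hcore hP2 hP5 h6 hct T) (hMu P hP l hl h5 hcore hP2 hP5 h6 hct T) h2

end Summit.ABC.IUTFork.Conditional.SigmaMass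

end
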